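import Literature.AnabelianGeometry.EtaleTheta.LogDivisorModelTateTowerKummerTwistLevelAction
import Literature.AnabelianGeometry.EtaleTheta.LogDivisorModelTateTowerKummerTwistCompat

/-!
# [EtTh] Def. 3.3 (iii) v2: the ζ-TWISTED Kummer–Tate TOWER — a `LogDivisorTower` over the compatible group
# `Ẑ(1)² ⋊ Ẑˣ × ℤ_γ` whose levels RECORD the roots of unity and whose constant field MOVES under the Galois group

S. Mochizuki, *The étale theta function …*, Publ. RIMS **45** (2009) [MochizukiEtTh2009], §1 p.13 («`K_N := K(ζ_N,
q_X^{1/N})`»), §3 Def. 3.1 / Prop. 3.2 (PDF p.70), Def. 3.3 (i)(c)/(ii)/(iii) pp.72–74 [cite: MochizukiEtTh2009, Def 3.3 (iii) p.73].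
CLASS (b) MODEL / NON-VACUITY WITNESS (abc-iut cell, layer L2; L2-lead rows R677 / R689 / R722 «piece (d) — the tower over
'TateTowerKummerTwist.Compat'/'levelsC' BY NAME»; seat abc-iut-L2-d2 gen 6).  Consumed BY NAME, nothing restated: abc-iut-L2-t3's
`LevelSystem` / `LogDivisorTower`; abc-iut-L1-t6's group `TateTowerKummerTwist.Grp = (K ⋊_χ C) × ℤ_γ` (`M n = (n+2)!`,
`closure`; p471292) and compatible subgroup `compat ≅ Ẑ(1)² ⋊ Ẑˣ × ℤ_γ`, `levelsC` (`res`, `resK`, `resC`, `closureC`;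
p472997); this seat's levels `TateTowerTwist.model μ`, twist group `Twist μ`, `actionOf`, `zmodChar` (p475299, p476241);
abc-iut-w6-d058's ramification indices `TateTowerKummer.e`, `pow_injective_fn`.
* §1 level `n` has modulus `N n = (n+1)!`, roots of unity `MuN n = μ_{(n+1)!}`.  WHY `(n+1)!` AND NOT `M n = (n+2)!` (the
  modulus of abc-iut-L1-t6's plug `toTwist n`, p476598): the tower law `act_closure_fn` wants `Δ_n` trivial AT level `n`;
  `Δ_n = closure n` constrains the Kummer coordinates of index `< n` only, so inside `compat` the index-`n` class is `≡ 0
  (mod M_{n−1} = (n+1)!)` and NOT mod `M_n` (the compatible integer `κ = (n+1)!` lies in `Δ_n` and moves `U^{1/(n+2)!}`;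
  `toTwist_eq_one_of_mem_closure` accordingly needs `n < m`).  Hence level `n` READS the index-`n` coordinates REDUCED
  `castN n : ℤ/M_n → ℤ/N_n` (so `MuN (n+1)` is L1-t6's `Mu n` as a type, and `up`/`rho` below are the level-`0`-extended,
  index-shifted counterparts of its `inflate`/`toTwist`); inclusion `up : μ_{N i} ↪ μ_{N j}` (`x ↦ e·x̃`, `e = eN i j =
  (j+1)!/(i+1)!`), key identity `upAdd_castHom` (reduce then include = `·e`).
* §2 level-`n` action `rho n : Grp →* Twist (MuN n)` (`U`-Kummer class and cyclotomic character of index `n` mod `N n`,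
  translation; the `ϖ`-root coordinate acts TRIVIALLY — it cannot commute with the chain shear), `actC n` on `Compat`.
* §3 **`towerC : LogDivisorTower Compat levelsC`**, every field a definition or a theorem; equivariance of the transitions
  holds EXACTLY by the compatibilities defining `compat` (`up_chiN`, `up_kumN`; abc-iut-L1-t6's finding (b′) made kernel).
* §4 NON-VACUITY: `conjC` (character `−1`) acts on level-`n` constants by `ζ ↦ ζ⁻¹`, moving one for `n ≥ 2`; `kumOneC`
  (Kummer class `1 ∈ Ẑ(1)`) sends `U_n ↦ ζ_{N n}·U_n ≠ U_n` for `n ≥ 1`.  `RootLaw` / `isTempered` = sequels.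
HONEST LABEL: a class-(b) combinatorial DESIGN model (finite groups of roots of unity adjoined level-wise to the Tate
skeleton), NOT the tempered tower of a Tate curve; the constant field's Galois group acts on `μ` only; nothing here bears
on [IUTchIII] Cor. 3.12; no side taken; typed ≠ proved.
-/

noncomputable section

namespace Literature.AnabelianGeometry.EtaleTheta

open CategoryTheory Function Literature.AlgebraicGeometry.Frobenioids
  Literature.AlgebraicGeometry.Frobenioids.QuasiTemperoid Literature.AnabelianGeometry.SemiGraphs

namespace TateTowerKummerTwist

open LogDivisorModel LogDivisorModel.TateTowerTwist

/-! ## §1 The modulus `N n = (n+1)!` of a level, the roots of unity `μ_{N n}`, reduction and inclusion -/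

/-- The modulus of level `n`: `N n = (n+1)!` (positive, so `ℤ/N n` is finite by instance). [cite: MochizukiEtTh2009, Def 3.3 (ii) p.73] -/
def N (n : ℕ) : ℕ+ := ⟨(n + 1).factorial, Nat.factorial_pos _⟩

/-- `N n = (n+1)!`. [cite: MochizukiEtTh2009, Def 3.3 (ii) p.73] -/
@[simp] theorem coe_N (n : ℕ) : ((N n : ℕ+) : ℕ) = (n + 1).factorial := rfl

/-- `N n ∣ M n = (n+2)!`. [cite: MochizukiEtTh2009, Def 3.3 (ii) p.73] -/
theorem N_dvd_M (n : ℕ) : ((N n : ℕ+) : ℕ) ∣ M n := Nat.factorial_dvd_factorial (by omega)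

/-- `N i ∣ N j` for `i ≤ j`. [cite: MochizukiEtTh2009, Def 3.3 (ii) p.73] -/
theorem N_dvd_N {i j : ℕ} (h : i ≤ j) : ((N i : ℕ+) : ℕ) ∣ N j := Nat.factorial_dvd_factorial (by omega)

/-- The ramification index `eN i j = (j+1)!/(i+1)!` (`TateTowerKummer.e`, shifted). [cite: MochizukiEtTh2009, Def 3.3 (ii) p.73] -/
def eN (i j : ℕ) : ℕ := TateTowerKummer.e (i + 1) (j + 1)

/-- `N i · eN i j = N j`. [cite: MochizukiEtTh2009, Def 3.3 (ii) p.73] -/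
theorem N_mul_eN {i j : ℕ} (h : i ≤ j) : ((N i : ℕ+) : ℕ) * eN i j = N j :=
  TateTowerKummer.factorial_mul_e (by omega)

/-- `eN i i = 1`. [cite: MochizukiEtTh2009, Def 3.3 (ii) p.73] -/
theorem eN_self (i : ℕ) : eN i i = 1 := TateTowerKummer.e_self _

/-- `eN i j · eN j k = eN i k`. [cite: MochizukiEtTh2009, Def 3.3 (ii) p.73] -/
theorem eN_mul_eN {i j k : ℕ} (hij : i ≤ j) (hjk : j ≤ k) : eN i j * eN j k = eN i k :=
  TateTowerKummer.e_mul_e (by omega) (by omega)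

/-- `eN i j ≥ 1`. [cite: MochizukiEtTh2009, Def 3.3 (ii) p.73] -/
theorem eN_pos {i j : ℕ} (h : i ≤ j) : 0 < eN i j := TateTowerKummer.e_pos (by omega)

/-- The roots of unity of level `n`: `μ_{N n} = Multiplicative (ℤ/N n)`. [cite: MochizukiEtTh2009, §1 p.13] -/
abbrev MuN (n : ℕ) : Type := Multiplicative (ZMod (N n))

/-- Reduction of the index-`n` coordinates `ℤ/M_n → ℤ/N_n`. [cite: MochizukiEtTh2009, Def 3.3 (ii) p.73] -/
def castN (n : ℕ) : ZMod (M n) →+* ZMod (N n) := ZMod.castHom (N_dvd_M n) (ZMod (N n))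

/-- Reductions commute: `castN i ∘ res = (ℤ/N_j → ℤ/N_i) ∘ castN j`. [cite: MochizukiEtTh2009, Def 3.3 (ii) p.73] -/
theorem castN_res {i j : ℕ} (h : i ≤ j) (x : ZMod (M j)) :
    castN i (res h x) = ZMod.castHom (N_dvd_N h) (ZMod (N i)) (castN j x) :=
  RingHom.congr_fun (Subsingleton.elim ((castN i).comp (res h)) ((ZMod.castHom (N_dvd_N h) _).comp (castN j))) x

/-- A ring map sends the unit `−1` to `−1` (for `Units.map` along `toMonoidHom`). [cite: MochizukiEtTh2009, §1 p.13] -/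
theorem unitsMap_neg_one {R S : Type} [Ring R] [Ring S] (f : R →+* S) : Units.map f.toMonoidHom (-1) = -1 :=
  Units.ext (by
    change f ((-1 : Rˣ) : R) = ((-1 : Sˣ) : S); rw [Units.val_neg, Units.val_one, map_neg, map_one, Units.val_neg, Units.val_one])

/-- **The inclusion of roots of unity `μ_{N i} ↪ μ_{N j}`, additively**: `x ↦ e·x̃` (`ζ_{N_i} = ζ_{N_j}^{e}`; well defined as
`N_i · e = N_j`). [cite: MochizukiEtTh2009, §1 p.13] -/
def upAdd {i j : ℕ} (h : i ≤ j) : ZMod (N i) →+ ZMod (N j) :=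
  ZMod.lift (N i : ℕ) ⟨(AddMonoidHom.mulRight ((eN i j : ℕ) : ZMod (N j))).comp (Int.castAddHom (ZMod (N j))), by
    change ((((N i : ℕ+) : ℕ) : ℤ) : ZMod (N j)) * ((eN i j : ℕ) : ZMod (N j)) = 0
    rw [Int.cast_natCast, ← Nat.cast_mul, N_mul_eN h]
    exact ZMod.natCast_self _⟩

/-- `upAdd` on an integer: `z ↦ z·e`. [cite: MochizukiEtTh2009, §1 p.13] -/
theorem upAdd_intCast {i j : ℕ} (h : i ≤ j) (z : ℤ) :
    upAdd h (z : ZMod (N i)) = (z : ZMod (N j)) * ((eN i j : ℕ) : ZMod (N j)) :=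
  ZMod.lift_coe _ _ z

/-- **Key identity**: reduce `ℤ/N_j → ℤ/N_i` then include back = multiplication by `e`. [cite: MochizukiEtTh2009, §1 p.13] -/
theorem upAdd_castHom {i j : ℕ} (h : i ≤ j) (y : ZMod (N j)) :
    upAdd h (ZMod.castHom (N_dvd_N h) (ZMod (N i)) y) = ((eN i j : ℕ) : ZMod (N j)) * y := by
  obtain ⟨z, rfl⟩ := ZMod.intCast_surjective y
  rw [map_intCast, upAdd_intCast, mul_comm]

/-- `upAdd` along `i ≤ i` is the identity (`e = 1`). [cite: MochizukiEtTh2009, §1 p.13] -/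
theorem upAdd_refl (i : ℕ) (x : ZMod (N i)) : upAdd le_rfl x = x := by
  obtain ⟨z, rfl⟩ := ZMod.intCast_surjective x
  rw [upAdd_intCast, eN_self, Nat.cast_one, mul_one]

/-- `upAdd` is transitive (`e_{ij} e_{jk} = e_{ik}`). [cite: MochizukiEtTh2009, §1 p.13] -/
theorem upAdd_trans {i j k : ℕ} (hij : i ≤ j) (hjk : j ≤ k) (x : ZMod (N i)) :
    upAdd hjk (upAdd hij x) = upAdd (hij.trans hjk) x := by
  obtain ⟨z, rfl⟩ := ZMod.intCast_surjective x
  rw [upAdd_intCast, upAdd_intCast, ← Int.cast_natCast (R := ZMod (N j)), ← Int.cast_mul, upAdd_intCast, Int.cast_mul,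
    Int.cast_natCast, mul_assoc, ← Nat.cast_mul, eN_mul_eN hij hjk]

/-- `upAdd` is injective (`N_j ∣ z e ⇒ N_i ∣ z`). [cite: MochizukiEtTh2009, §1 p.13] -/
theorem upAdd_injective {i j : ℕ} (h : i ≤ j) : Injective (upAdd h) := by
  refine (injective_iff_map_eq_zero _).2 fun x hx => ?_
  obtain ⟨z, rfl⟩ := ZMod.intCast_surjective x
  rw [upAdd_intCast, ← Int.cast_natCast, ← Int.cast_mul, ZMod.intCast_zmod_eq_zero_iff_dvd] at hx
  rw [ZMod.intCast_zmod_eq_zero_iff_dvd]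
  have he : ((eN i j : ℕ) : ℤ) ≠ 0 := by exact_mod_cast (eN_pos h).ne'
  rw [← N_mul_eN h, Nat.cast_mul] at hx
  exact (mul_dvd_mul_iff_right he).1 hx

/-- The inclusion of roots of unity `μ_{N i} → μ_{N j}` (multiplicatively). [cite: MochizukiEtTh2009, §1 p.13] -/
def up {i j : ℕ} (h : i ≤ j) : MuN i →* MuN j := AddMonoidHom.toMultiplicative (upAdd h)

/-- `up` additively. [cite: MochizukiEtTh2009, §1 p.13] -/
@[simp] theorem toAdd_up {i j : ℕ} (h : i ≤ j) (ζ : MuN i) :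
    Multiplicative.toAdd (up h ζ) = upAdd h (Multiplicative.toAdd ζ) := rfl

/-! ## §2 The level-`n` action of `Grp` through the finite-level twist group `(μ_{N n} ⋊ Aut μ_{N n}) × ℤ_γ` -/

/-- The `U`-Kummer class at level `n`: `k ↦ ζ_{N n}^{k_n.2 mod N n}` (second coordinate = roots of `U`; the first, roots
of `ϖ`, is not used). [cite: MochizukiEtTh2009, Def 3.3 (ii) p.73] -/
def kumN (n : ℕ) : Kum →* MuN n :=
  AddMonoidHom.toMultiplicative ((((castN n).toAddMonoidHom.comp (AddMonoidHom.snd _ _)).comp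
    (Pi.evalAddMonoidHom (fun m => ZMod (M m) × ZMod (M m)) n)))

/-- `kumN` additively. [cite: MochizukiEtTh2009, Def 3.3 (ii) p.73] -/
@[simp] theorem toAdd_kumN (n : ℕ) (k : Kum) :
    Multiplicative.toAdd (kumN n k) = castN n (Multiplicative.toAdd k n).2 := rfl

/-- The cyclotomic character at level `n` on `μ_{N n}`: `c ↦ (ζ ↦ ζ^{c_n mod N n})`. [cite: MochizukiEtTh2009, §1 p.13] -/
def chiN (n : ℕ) : Cst →* MulAut (MuN n) :=
  (zmodChar (N n)).comp ((Units.map (castN n).toMonoidHom).comp (Pi.evalMonoidHom (fun m => (ZMod (M m))ˣ) n))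

/-- `chiN`, additively on any root of unity. [cite: MochizukiEtTh2009, §1 p.13] -/
theorem toAdd_chiN (n : ℕ) (c : Cst) (ζ : MuN n) :
    Multiplicative.toAdd (chiN n c ζ) = castN n (c n : ZMod (M n)) * Multiplicative.toAdd ζ := rfl

/-- The character intertwines the Kummer class, `kumN (χ(c)·k) = χ_n(c) (kumN k)`: `(kumN, chiN)` is a map of semidirect
products. [cite: MochizukiEtTh2009, §1 p.13] -/
theorem kumN_act (n : ℕ) (c : Cst) :
    (kumN n).comp (act c).toMonoidHom = ((MonoidHom.id (MulAut (MuN n))) (chiN n c)).toMonoidHom.comp (kumN n) := by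
  refine MonoidHom.ext fun k => Multiplicative.toAdd.injective ?_
  change castN n ((act c k).toAdd n).2 = castN n (c n : ZMod (M n)) * castN n (k.toAdd n).2
  rw [toAdd_act_apply, Prod.smul_snd, Units.smul_def, smul_eq_mul, map_mul]

/-- **The level-`n` action of `Grp` through the finite twist group `(μ_{N n} ⋊ Aut μ_{N n}) × ℤ_γ`**: Kummer class and
character of index `n` mod `N n`, translation kept. [cite: MochizukiEtTh2009, Def 3.3 (ii) p.73] -/
def rho (n : ℕ) : Grp →* Twist (MuN n) :=
  (SemidirectProduct.map (kumN n) (chiN n) (kumN_act n)).prodMap (MonoidHom.id (Multiplicative ℤ))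

/-- `rho`: Kummer component. [cite: MochizukiEtTh2009, Def 3.3 (ii) p.73] -/
@[simp] theorem rho_left (n : ℕ) (g : Grp) : (rho n g).1.left = kumN n g.1.left := rfl
/-- `rho`: character component. [cite: MochizukiEtTh2009, Def 3.3 (ii) p.73] -/
@[simp] theorem rho_right (n : ℕ) (g : Grp) : (rho n g).1.right = chiN n g.1.right := rfl

/-- The level-`n` Galois action of `Compat` on `model (MuN n)`: pull-back of `action` along `rho n ∘ compat.subtype`.
[cite: MochizukiEtTh2009, Def 3.3 (iii) p.73] -/
def actC (n : ℕ) : (model (MuN n)).GaloisAction Compat := actionOf (MuN n) ((rho n).comp compat.subtype)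

/-- `actC` on functions. [cite: MochizukiEtTh2009, Def 3.3 (iii) p.73] -/
theorem actC_actFn_apply (n : ℕ) (g : Compat) (f : Fn (MuN n)) :
    (actC n).actFn g f = actFnHom (rho n (g : Grp)) f := rfl

/-- **`Δ_n` acts trivially on the level-`n` Kummer class inside `compat`** (`n = 0`: `μ_1`; `n = m+1`: `k_{m+1} ≡ k_m = 0
(mod M_m)`). [cite: MochizukiEtTh2009, Def 3.3 (i) p.72] -/
theorem kumN_eq_one_of_mem_closureC {n : ℕ} {g : Compat} (hg : g ∈ closureC n) : kumN n (g : Grp).1.left = 1 := by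
  refine Multiplicative.toAdd.injective ?_
  rw [toAdd_kumN, toAdd_one]
  obtain ⟨-, -, hk⟩ := (mem_closure_iff n (g : Grp)).1 ((mem_closureC_iff n g).1 hg)
  rcases n with _ | m
  · haveI : Subsingleton (ZMod (N 0)) := ZMod.subsingleton_iff.2 rfl
    exact Subsingleton.elim _ _
  · -- `castN (m+1)` IS L1-t6's `res : ℤ/M_{m+1} → ℤ/M_m` (`N_{m+1} = M_m`; ring maps out of `ℤ/M` are unique)
    have hc := g.2.1 m (m + 1) (Nat.le_succ m)
    rw [RingHom.congr_fun (Subsingleton.elim (castN (m + 1)) (res (Nat.le_succ m))) _]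
    change (resK (Nat.le_succ m) ((g : Grp).1.left.toAdd (m + 1))).2 = 0
    rw [hc, hk m (Nat.lt_succ_self m), Prod.snd_zero]

/-- `rho n g = 1` for `g ∈ Δ_n ∩ compat`. [cite: MochizukiEtTh2009, Def 3.3 (i) p.72] -/
theorem rho_eq_one_of_mem_closureC {n : ℕ} {g : Compat} (hg : g ∈ closureC n) : rho n (g : Grp) = 1 := by
  obtain ⟨h2, hr, -⟩ := (mem_closure_iff n (g : Grp)).1 ((mem_closureC_iff n g).1 hg)
  refine Prod.ext (SemidirectProduct.ext ?_ ?_) ?_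
  · rw [rho_left, kumN_eq_one_of_mem_closureC hg]; rfl
  · rw [rho_right, hr, map_one]; rfl
  · change ((g : Grp)).2 = 1; exact h2

/-! ## §3 The transitions, their equivariance ON `compat`, and the tower -/

/-- The transition on functions (`i ≤ j`): `(ζ, ϖ_i^c U_i^k) ↦ (up ζ, ϖ_j^{ec} U_j^{ek})` — roots of unity included,
exponents raised to the ramification index. [cite: MochizukiEtTh2009, Def 3.3 (iii) p.73] -/
def resFnC {i j : ℕ} (h : i ≤ j) : Fn (MuN i) →* Fn (MuN j) := (up h).prodMap (powMonoidHom (eN i j))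

/-- `resFnC` evaluated. [cite: MochizukiEtTh2009, Def 3.3 (iii) p.73] -/
@[simp] theorem resFnC_apply {i j : ℕ} (h : i ≤ j) (f : Fn (MuN i)) : resFnC h f = (up h f.1, f.2 ^ eN i j) := rfl

/-- **(A) the character commutes with the inclusion of roots of unity on `compat`** (`c_j ≡ c_i (mod M_i)`).
[cite: MochizukiEtTh2009, §1 p.13] -/
theorem up_chiN {i j : ℕ} (h : i ≤ j) (g : Compat) (ζ : MuN i) :
    up h (chiN i (g : Grp).1.right ζ) = chiN j (g : Grp).1.right (up h ζ) := by
  refine Multiplicative.toAdd.injective ?_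
  rw [toAdd_up, toAdd_chiN, toAdd_chiN, toAdd_up]
  obtain ⟨y, hy⟩ := ZMod.castHom_surjective (N_dvd_N h) (Multiplicative.toAdd ζ)
  have hc : castN i ((g : Grp).1.right i : ZMod (M i)) =
      ZMod.castHom (N_dvd_N h) (ZMod (N i)) (castN j ((g : Grp).1.right j : ZMod (M j))) := by
    rw [← castN_res h, ← g.2.2 i j h]; rfl
  rw [← hy, hc, ← map_mul, upAdd_castHom, upAdd_castHom, mul_left_comm]

/-- **(B) the Kummer classes are norm-compatible on `compat`**: `up (kumN i k) = (kumN j k)^e` (`k_j ≡ k_i (mod M_i)`).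
[cite: MochizukiEtTh2009, Def 3.3 (ii) p.73] -/
theorem up_kumN {i j : ℕ} (h : i ≤ j) (g : Compat) : up h (kumN i (g : Grp).1.left) = kumN j (g : Grp).1.left ^ eN i j := by
  refine Multiplicative.toAdd.injective ?_
  rw [toAdd_up, toAdd_kumN, toAdd_pow, toAdd_kumN, nsmul_eq_mul]
  have hk : ((g : Grp).1.left.toAdd i).2 = res h ((g : Grp).1.left.toAdd j).2 := by rw [← g.2.1 i j h]; rfl
  rw [hk, castN_res, upAdd_castHom]

/-- **EQUIVARIANCE of the transitions on `compat`**, `resFnC (g ·_i f) = g ·_j (resFnC f)`: exactly (A) + (B)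
(abc-iut-L1-t6's finding (b′) made kernel). [cite: MochizukiEtTh2009, Def 3.3 (iii) p.73] -/
theorem resFnC_actFnHom {i j : ℕ} (h : i ≤ j) (g : Compat) (f : Fn (MuN i)) :
    resFnC h (actFnHom (rho i (g : Grp)) f) = actFnHom (rho j (g : Grp)) (resFnC h f) := by
  refine Prod.ext ?_ ?_
  · change up h (chiN i (g : Grp).1.right f.1 * kumN i (g : Grp).1.left ^ (Multiplicative.toAdd f.2).2) =
      chiN j (g : Grp).1.right (up h f.1) * kumN j (g : Grp).1.left ^ (Multiplicative.toAdd (f.2 ^ eN i j)).2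
    rw [map_mul, map_zpow, up_chiN, up_kumN, toAdd_pow, Prod.smul_snd, nsmul_eq_mul, zpow_mul, zpow_natCast]
  · change TateTower.shearFn (Multiplicative.toAdd (g : Grp).2) f.2 ^ eN i j =
      TateTower.shearFn (Multiplicative.toAdd (g : Grp).2) (f.2 ^ eN i j)
    exact (map_pow _ _ _).symm

/-- `i ≤ j` from `Δ_j ⊆ Δ_i` inside `compat` (abc-iut-L1-t6). [cite: MochizukiEtTh2009, Def 3.3 (i) p.72] -/
theorem le_of_levelsC {i j : ℕ} (h : levelsC.closure j ≤ levelsC.closure i) : i ≤ j := levelsC_le_of_closure_le h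

/-- **The ζ-twisted Kummer–Tate tower** over the compatible group (every field a definition or a theorem): level `n` =
`model (MuN n)` (`μ_{(n+1)!} × ⟨ϖ_n⟩ × ⟨U_n⟩`), `Compat` acting through `rho n` (Kummer twist of `U_n`, CHARACTER on `μ`,
translation), `Δ_n` trivial at level `n`, transitions = inclusion of roots of unity × ramification index, equivariant
exactly by the compatibilities defining `compat`. [cite: MochizukiEtTh2009, Def 3.3 (iii) p.73] -/
def towerC : LogDivisorTower Compat levelsC where
  Z n := model (MuN n)
  cuspLaws n := TateTowerTwist.cuspLaws (MuN n)
  act n := actC n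
  act_closure_fn n g hg := by
    change actFnHom (rho n (g : Grp)) = 1
    rw [rho_eq_one_of_mem_closureC hg, map_one]
  act_closure_div n g hg := by
    obtain ⟨h2, -, -⟩ := (mem_closure_iff n (g : Grp)).1 ((mem_closureC_iff n g).1 hg)
    change TateTower.actDIVHom ((g : Grp)).2 = 1
    rw [h2, map_one]
  resFn {_ _} h := resFnC (le_of_levelsC h)
  resDIV {i j} _ := powMonoidHom (eN i j)
  resFn_refl i f := by
    change (up le_rfl f.1, f.2 ^ eN i i) = f
    refine Prod.ext (Multiplicative.toAdd.injective ?_) ?_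
    · rw [toAdd_up, upAdd_refl]
    · rw [eN_self, pow_one]
  resFn_trans {i j k} hij hjk f := by
    change (up ((le_of_levelsC hij).trans (le_of_levelsC hjk)) f.1, f.2 ^ eN i k) =
      (up (le_of_levelsC hjk) (up (le_of_levelsC hij) f.1), (f.2 ^ eN i j) ^ eN j k)
    refine Prod.ext (Multiplicative.toAdd.injective ?_) ?_
    · rw [toAdd_up, toAdd_up, toAdd_up, upAdd_trans (le_of_levelsC hij) (le_of_levelsC hjk)]
    · rw [← pow_mul, eN_mul_eN (le_of_levelsC hij) (le_of_levelsC hjk)]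
  resDIV_refl i d := by
    change d ^ eN i i = d
    rw [eN_self, pow_one]
  resDIV_trans {i j k} hij hjk d := by
    change d ^ eN i k = (d ^ eN i j) ^ eN j k
    rw [← pow_mul, eN_mul_eN (le_of_levelsC hij) (le_of_levelsC hjk)]
  resFn_injective {i j} h := fun a b hab =>
    Prod.ext (Multiplicative.toAdd.injective (upAdd_injective (le_of_levelsC h)
        (congrArg (fun f : Fn (MuN j) => Multiplicative.toAdd f.1) hab)))
      (TateTowerKummer.pow_injective_fn (eN_pos (le_of_levelsC h)) (congrArg Prod.snd hab))
  resFn_mem_logMero _ _ _ := trivial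
  resFn_mem_const {i j} h f hf := by
    have hk := (mem_const_iff (MuN i) f).1 hf
    refine (mem_const_iff (MuN j) _).2 ?_
    change (Multiplicative.toAdd (f.2 ^ eN i j)).2 = 0
    rw [toAdd_pow, Prod.smul_snd, hk, smul_zero]
  resFn_mem_intConst {i j} h f hf := by
    obtain ⟨hc, hk⟩ := hf
    refine ⟨?_, ?_⟩
    · change 0 ≤ (Multiplicative.toAdd (f.2 ^ eN i j)).1
      rw [toAdd_pow, Prod.smul_fst]
      exact nsmul_nonneg hc _
    · change (Multiplicative.toAdd (f.2 ^ eN i j)).2 = 0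
      rw [toAdd_pow, Prod.smul_snd, hk, smul_zero]
  resDIV_mem_DIVplus {i j} _ d hd := Submonoid.pow_mem _ hd _
  resDIV_mem_Div _ _ _ := trivial
  resDIV_mem_nonCuspidal _ _ _ := trivial
  resDIV_mem_cuspidal {i j} _ d hd := Subgroup.pow_mem _ hd _
  divisor_resFn {i j} _ f := by
    change TateTower.divHom (f.1.2 ^ eN i j) = TateTower.divHom f.1.2 ^ eN i j
    exact map_pow _ _ _
  resFn_act {i j} h g f := resFnC_actFnHom (le_of_levelsC h) g f
  resDIV_act {i j} _ g d := (map_pow (TateTower.shiftDIV (Multiplicative.toAdd (g : Grp).2)) d _).symm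

/-- A multi-level inhabitant of the v2 interface WITH RECORDED ROOTS OF UNITY. [cite: MochizukiEtTh2009, Def 3.3 (iii) p.73] -/
theorem nonempty_towerC : Nonempty (LogDivisorTower Compat levelsC) := ⟨towerC⟩
/-! ## §4 Content: the constant field MOVES, the Kummer part TWISTS (stated at `actC n = towerC.act n`, `towerC.Z n = model (MuN n)`) -/

/-- **«Complex conjugation»** in `Compat`: character `−1` at every level, trivial Kummer part, no translation.
[cite: MochizukiEtTh2009, §1 p.13] -/
def conjC : Compat :=
  ⟨(SemidirectProduct.inr fun _ => -1, 1),
    ⟨fun i j h => by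
      rw [SemidirectProduct.left_inr, toAdd_one, Pi.zero_apply, Pi.zero_apply, map_zero],
     fun i j h => by
      rw [SemidirectProduct.right_inr]
      exact unitsMap_neg_one (res h)⟩⟩

/-- `conjC` acts on the roots of unity of level `n` by INVERSION: `ζ ↦ ζ⁻¹`. [cite: MochizukiEtTh2009, §1 p.13] -/
theorem actFn_conjC_zeta (n : ℕ) (ζ : MuN n) : (actC n).actFn conjC (zeta (MuN n) ζ) = zeta (MuN n) ζ⁻¹ := by
  rw [actC_actFn_apply, actFnHom_zeta, rho_right]
  refine congrArg (zeta (MuN n)) (Multiplicative.toAdd.injective ?_)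
  rw [toAdd_chiN, toAdd_inv]
  change castN n (((-1 : (ZMod (M n))ˣ) : ZMod (M n))) * Multiplicative.toAdd ζ = -Multiplicative.toAdd ζ
  rw [Units.val_neg, Units.val_one, map_neg, map_one, neg_one_mul]

/-- `rho n conjC` is the pure character element `−1` of the finite twist group. [cite: MochizukiEtTh2009, §1 p.13] -/
theorem rho_conjC (n : ℕ) : rho n (conjC : Grp) = (SemidirectProduct.inr (zmodChar (N n) (-1)), 1) := by
  refine Prod.ext (SemidirectProduct.ext ?_ ?_) rfl
  · rw [rho_left]
    change kumN n 1 = 1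
    exact map_one _
  · rw [rho_right, SemidirectProduct.right_inr]
    change zmodChar (N n) (Units.map (castN n).toMonoidHom (-1)) = zmodChar (N n) (-1)
    rw [unitsMap_neg_one]

/-- **NON-VACUITY OF THE CONSTANT-FIELD ACTION IN THE TOWER**: at every level `n ≥ 2` (`μ_{(n+1)!} ⊋ {±1}`) `conjC`
MOVES a constant of `Z_∞^{(n)}` — the Galois group acts on the constant fields through a NON-TRIVIAL cyclotomic character.
[cite: MochizukiEtTh2009, §1 p.13] -/
theorem exists_const_ne_conjC {n : ℕ} (hn : 2 ≤ n) :
    ∃ f ∈ (model (MuN n)).const, (actC n).actFn conjC f ≠ f := by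
  have hlt : 2 < ((N n : ℕ+) : ℕ) := by
    rw [coe_N]
    exact lt_of_lt_of_le (by decide : 2 < (2 + 1).factorial) (Nat.factorial_le (by omega))
  obtain ⟨f, hf, hne⟩ := exists_const_ne_of_two_lt (m := (N n : ℕ)) hlt
  refine ⟨f, hf, fun h => hne ?_⟩
  have h' : actFnHom (rho n (conjC : Grp)) f = f := h
  rw [rho_conjC] at h'
  exact h'

/-- **The compatible Kummer class `1 ∈ Ẑ(1)` on the `U`-coordinate** (`k_n = (0, 1)` at every level), trivial character,
no translation. [cite: MochizukiEtTh2009, Def 3.3 (ii) p.73] -/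
def kumOneC : Compat :=
  ⟨(SemidirectProduct.inl (Multiplicative.ofAdd fun n => ((0 : ZMod (M n)), (1 : ZMod (M n)))), 1),
    ⟨fun i j h => by
      rw [SemidirectProduct.left_inl, toAdd_ofAdd]
      exact Prod.ext (map_zero (res h)) (map_one (res h)),
     fun i j h => by rw [SemidirectProduct.right_inl, Pi.one_apply, Pi.one_apply, map_one]⟩⟩

/-- **The Kummer part TWISTS the `U`-root**: `kumOneC · U_n = ζ_{N n} · U_n` at every level. [cite: MochizukiEtTh2009, Def 3.3 (ii) p.73] -/
theorem actFn_kumOneC_coordU (n : ℕ) :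
    (actC n).actFn kumOneC (coordU (MuN n)) =
      (Multiplicative.ofAdd (1 : ZMod (N n)), Multiplicative.ofAdd ((0 : ℤ), (1 : ℤ))) := by
  rw [actC_actFn_apply, actFnHom_coordU, rho_left]
  refine Prod.ext (Multiplicative.toAdd.injective ?_) ?_
  · rw [toAdd_kumN, toAdd_ofAdd]
    change castN n (1 : ZMod (M n)) = 1
    exact map_one _
  · change Multiplicative.ofAdd (-Multiplicative.toAdd (1 : Multiplicative ℤ), (1 : ℤ)) = _
    rw [toAdd_one, neg_zero]

/-- … and `ζ_{N n} · U_n ≠ U_n` for `n ≥ 1` (`N n ≥ 2`): the Kummer action on functions is NON-TRIVIAL.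
[cite: MochizukiEtTh2009, Def 3.3 (ii) p.73] -/
theorem actFn_kumOneC_coordU_ne {n : ℕ} (hn : 1 ≤ n) : (actC n).actFn kumOneC (coordU (MuN n)) ≠ coordU (MuN n) := by
  haveI : Fact (1 < ((N n : ℕ+) : ℕ)) :=
    ⟨by rw [coe_N]; exact lt_of_lt_of_le (by decide : 1 < (1 + 1).factorial) (Nat.factorial_le (by omega))⟩
  rw [actFn_kumOneC_coordU]
  intro h
  have h1 := congrArg (fun f : Fn (MuN n) => Multiplicative.toAdd f.1) h
  change (1 : ZMod (N n)) = Multiplicative.toAdd (1 : MuN n) at h1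
  rw [toAdd_one] at h1
  exact one_ne_zero h1

end TateTowerKummerTwist

end Literature.AnabelianGeometry.EtaleTheta

end
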